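import Summits.RiemannHypothesis.RiemannHypothesis.Theorems.PfPersistenceMarkovCoreExistence
import HarnessLib

/-!
# PF persistence (theory 1, edge law): THE MARKOV CORE OF A NON-NEGATIVE WEIGHT TABLE, XI —
# the strict dial law: the core bottom sees every prime power below `2a`

Helper file (`--supports stmt-RiemannHypothesis-19953`); mechanism/rigidity campaign; no RH claims.
Eleventh file of the chain `PfPersistenceMarkovCore*`.  File IX shows that the bottom
`coreBottom w a` of the Markov core is monotone, concave and 4-Lipschitz in the table and (file VII,
the twin wall) depends on the table ONLY through its values on `weilPrimeIndex a`.  This file proves the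
converse sharpness: the bottom is STRICTLY monotone in EACH weight `w n` with `n ∈ weilPrimeIndex a`,
`n ≥ 2` — every prime power strictly inside the window is seen.

* `weilIncrement_pos_of_coreAdm` — a normalised member of the finite-energy class of the window has
  `D_t(f) > 0` at every length `t ≠ 0` (a `t`-periodic function supported in `[-a, a]` vanishes);
* `coreBottom_lt_of_lt` — `0 ≤ w ≤ w'` on the index and `w n < w' n` at one `n ∈ weilPrimeIndex a`,
  `n ≥ 2` ⇒ `coreBottom w a < coreBottom w' a` (test the smaller table on the ground state of the
  larger one, which exists by file VI);
* corollaries: the arch-only floor is attained ONLY by tables vanishing at every `n ≥ 2` of the index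
  (`coreBottom_archOnly_lt`), deleting a charged prime power strictly lowers the bottom
  (`coreBottom_indicator_lt`), a strict dial-down at a charged prime power strictly lowers it
  (`coreBottom_dial_lt`).

(`n = 0, 1` carry the length `log n = 0`, where `D_0 = 0`: those two index points are invisible, which is
why `2 ≤ n` is required.)  RH-free, operator-free, every window `a > 0`, the whole non-negative class —
structure of the class, no ζ-specific content.

## References

* M. Reed, B. Simon, *Methods of Modern Mathematical Physics IV* (1978), §XIII.12 (strict monotonicity
  of a non-degenerate ground energy under a positive perturbation charged by the ground state).
* E. Bombieri, Rend. Mat. Acc. Lincei (9) 11 (2000) 183–233, Thm 2.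
-/

set_option linter.dupNamespace false

noncomputable section

open MeasureTheory Set Filter
open scoped Topology ENNReal NNReal

namespace Summit.RiemannHypothesis.RiemannHypothesis.Theorems.PfPersistence

open Literature.NumberTheory.LFunctions

variable {a : ℝ} {w w' : ℕ → ℝ}

/-! ## §1 Increments of class members are positive at every non-zero length -/

/-- A normalised member of the finite-energy class has `D_t(f) > 0` for `t > 0`: if `D_t(f) = 0` then
`f(· + t) = f` a.e., so `f(x) = f(x + kt)` for all `k`, which vanishes once `x + kt > a`. [folklore] -/
theorem weilIncrement_pos_of_coreAdm_of_pos {f : ℝ → ℂ} (hf : coreAdm a f)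
    (hn : ∫ x, ‖f x‖ ^ 2 = (1 : ℝ)) {t : ℝ} (ht : 0 < t) : 0 < weilIncrement f t := by
  rcases (weilIncrement_nonneg f t).lt_or_eq with h | h
  · exact h
  exfalso
  -- the integrand of `D_t(f) = 0` vanishes a.e.
  have hL : MemLp f 2 := hf.1
  have hLt : MemLp (fun x ↦ f (x + t)) 2 :=
    hL.comp_measurePreserving (measurePreserving_add_right volume t)
  have hI : Integrable fun x ↦ ‖f (x + t) - f x‖ ^ 2 :=
    (memLp_two_iff_integrable_sq_norm (hLt.sub hL).1).1 (hLt.sub hL)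
  have hae : (fun x ↦ ‖f (x + t) - f x‖ ^ 2) =ᵐ[volume] 0 := by
    refine (integral_eq_zero_iff_of_nonneg (fun x ↦ by positivity) hI).1 ?_
    rw [← h.symm]; rfl
  have hper : ∀ᵐ x : ℝ, f (x + t) = f x := by
    filter_upwards [hae] with x hx
    have : ‖f (x + t) - f x‖ = 0 := pow_eq_zero_iff (n := 2) two_ne_zero |>.1 hx
    exact sub_eq_zero.1 (norm_eq_zero.1 this)
  -- transport along the translations `x ↦ x + k t`
  have hk : ∀ k : ℕ, ∀ᵐ x : ℝ, f (x + k * t + t) = f (x + k * t) := fun k ↦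
    (measurePreserving_add_right volume ((k : ℝ) * t)).quasiMeasurePreserving.tendsto_ae.eventually
      hper
  rw [← ae_all_iff] at hk
  have hzero : ∀ᵐ x : ℝ, f x = 0 := by
    filter_upwards [hk] with x hx
    have hind : ∀ k : ℕ, f (x + k * t) = f x := by
      intro k
      induction k with
      | zero => simp
      | succ k ih => rw [Nat.cast_succ, add_mul, one_mul, ← add_assoc, hx k, ih]
    obtain ⟨k, hk'⟩ := exists_nat_gt ((a - x) / t)
    have hgt : a < x + k * t := by
      have := (div_lt_iff₀ ht).1 hk'
      linarith
    rw [← hind k]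
    exact hf.2.1 _ fun hmem ↦ (not_le.2 hgt) hmem.2
  have h0 : ∫ x, ‖f x‖ ^ 2 = 0 := by
    rw [integral_congr_ae (g := fun _ ↦ (0 : ℝ))
      (hzero.mono fun x hx ↦ by simp only [hx, norm_zero, ne_eq, OfNat.ofNat_ne_zero,
        not_false_eq_true, zero_pow])]
    simp
  linarith

/-- **`D_t(f) > 0` at every `t ≠ 0`** for a normalised member of the finite-energy class of the
window. [folklore] -/
theorem weilIncrement_pos_of_coreAdm {f : ℝ → ℂ} (hf : coreAdm a f)
    (hn : ∫ x, ‖f x‖ ^ 2 = (1 : ℝ)) {t : ℝ} (ht : t ≠ 0) : 0 < weilIncrement f t := by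
  rcases lt_or_gt_of_ne ht with hneg | hpos
  · rw [← weilIncrement_neg]
    exact weilIncrement_pos_of_coreAdm_of_pos hf hn (neg_pos.2 hneg)
  · exact weilIncrement_pos_of_coreAdm_of_pos hf hn hpos

/-- In particular a core ground state charges every length `log n`, `n ≥ 2`. [folklore] -/
theorem IsCoreGround.weilIncrement_log_pos {u : ℝ → ℂ} (hu : IsCoreGround w a u) {n : ℕ}
    (h2 : 2 ≤ n) : 0 < weilIncrement u (Real.log n) :=
  weilIncrement_pos_of_coreAdm hu.1 hu.2.1
    (Real.log_pos (by exact_mod_cast lt_of_lt_of_le one_lt_two h2)).ne'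

/-! ## §2 The strict dial law -/

/-- `𝓔^{w'}_a(f) − 𝓔^w_a(f) = Σ_{index} (w' n − w n) D_{log n}(f)` (local copy of file IX's
`tableDirichletEnergy_sub_table`, kept private to leave this file independent of file IX). [folklore] -/
private theorem energy_sub_table (a : ℝ) (w w' : ℕ → ℝ) (f : ℝ → ℂ) :
    tableDirichletEnergy a w' f - tableDirichletEnergy a w f =
      ∑ n ∈ weilPrimeIndex a, (w' n - w n) * weilIncrement f (Real.log n) := by
  unfold tableDirichletEnergy
  rw [add_sub_add_right_eq_sub, ← Finset.sum_sub_distrib]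
  exact Finset.sum_congr rfl fun n _ ↦ by ring

/-- **STRICT MONOTONICITY OF THE CORE BOTTOM.**  If `0 ≤ w ≤ w'` on the prime index of the window and
`w n < w' n` at some `n ∈ weilPrimeIndex a` with `n ≥ 2`, then `coreBottom w a < coreBottom w' a`
(`a > 0`): the ground state `u'` of `w'` (file VI) has `D_{log n}(u') > 0`, so
`coreBottom w a ≤ 𝓔^w(u') = 𝓔^{w'}(u') − Σ (w' − w) D(u') < coreBottom w' a`. [folklore] -/
theorem coreBottom_lt_of_lt (hw : ∀ m ∈ weilPrimeIndex a, 0 ≤ w m)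
    (h : ∀ m ∈ weilPrimeIndex a, w m ≤ w' m) {n : ℕ} (hn : n ∈ weilPrimeIndex a) (h2 : 2 ≤ n)
    (hlt : w n < w' n) (ha : 0 < a) : coreBottom w a < coreBottom w' a := by
  have hw' : ∀ m ∈ weilPrimeIndex a, 0 ≤ w' m := fun m hm ↦ (hw m hm).trans (h m hm)
  obtain ⟨u, hu⟩ := exists_isCoreGround hw' ha
  have hD : 0 < weilIncrement u (Real.log n) := hu.weilIncrement_log_pos h2
  have h₁ : coreBottom w a ≤ tableDirichletEnergy a w u := coreBottom_le hw hu.1 hu.2.1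
  have h₂ := energy_sub_table a w w' u
  have h₃ : (w' n - w n) * weilIncrement u (Real.log n) ≤
      ∑ m ∈ weilPrimeIndex a, (w' m - w m) * weilIncrement u (Real.log m) :=
    Finset.single_le_sum (f := fun m ↦ (w' m - w m) * weilIncrement u (Real.log m))
      (fun m hm ↦ mul_nonneg (sub_nonneg.2 (h m hm)) (weilIncrement_nonneg u _)) hn
  have h₄ : 0 < (w' n - w n) * weilIncrement u (Real.log n) := mul_pos (sub_pos.2 hlt) hD
  have h₅ : tableDirichletEnergy a w' u = coreBottom w' a := hu.2.2
  linarith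

/-- **The floor is attained only by invisible tables**: a non-negative table charging some `n ≥ 2` of
the index lies STRICTLY above the arch-only floor. [folklore] -/
theorem coreBottom_archOnly_lt (hw : ∀ m ∈ weilPrimeIndex a, 0 ≤ w m) {n : ℕ}
    (hn : n ∈ weilPrimeIndex a) (h2 : 2 ≤ n) (hpos : 0 < w n) (ha : 0 < a) :
    coreBottom (fun _ ↦ (0 : ℝ)) a < coreBottom w a :=
  coreBottom_lt_of_lt (fun _ _ ↦ le_rfl) hw hn h2 hpos ha

/-- **Deleting a charged prime power strictly lowers the bottom.** [folklore] -/
theorem coreBottom_indicator_lt (hw : ∀ m ∈ weilPrimeIndex a, 0 ≤ w m) (S : Set ℕ) {n : ℕ}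
    (hn : n ∈ weilPrimeIndex a) (hnS : n ∉ S) (h2 : 2 ≤ n) (hpos : 0 < w n) (ha : 0 < a) :
    coreBottom (S.indicator w) a < coreBottom w a := by
  refine coreBottom_lt_of_lt (fun m hm ↦ Set.indicator_apply_nonneg fun _ ↦ hw m hm)
    (fun m hm ↦ Set.indicator_apply_le' (fun _ ↦ le_rfl) fun _ ↦ hw m hm) hn h2 ?_ ha
  rwa [Set.indicator_of_notMem hnS]

/-- **A strict dial-down at a charged prime power strictly lowers the bottom.** [folklore] -/
theorem coreBottom_dial_lt (hw : ∀ m ∈ weilPrimeIndex a, 0 ≤ w m) {K : ℕ → ℝ}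
    (hK : ∀ m, 0 ≤ K m ∧ K m ≤ 1) {n : ℕ} (hn : n ∈ weilPrimeIndex a) (h2 : 2 ≤ n)
    (hKn : K n < 1) (hpos : 0 < w n) (ha : 0 < a) :
    coreBottom (fun m ↦ K m * w m) a < coreBottom w a :=
  coreBottom_lt_of_lt (fun m hm ↦ mul_nonneg (hK m).1 (hw m hm))
    (fun m hm ↦ mul_le_of_le_one_left (hw m hm) (hK m).2) hn h2
    (by simpa using mul_lt_mul_of_pos_right hKn hpos) ha

/-- **A strict dial-up at a charged prime power strictly raises the bottom.** [folklore] -/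
theorem coreBottom_lt_dial (hw : ∀ m ∈ weilPrimeIndex a, 0 ≤ w m) {K : ℕ → ℝ}
    (hK : ∀ m, 1 ≤ K m) {n : ℕ} (hn : n ∈ weilPrimeIndex a) (h2 : 2 ≤ n)
    (hKn : 1 < K n) (hpos : 0 < w n) (ha : 0 < a) :
    coreBottom w a < coreBottom (fun m ↦ K m * w m) a :=
  coreBottom_lt_of_lt hw (fun m hm ↦ le_mul_of_one_le_left (hw m hm) (hK m)) hn h2
    (by simpa using mul_lt_mul_of_pos_right hKn hpos) ha

end Summit.RiemannHypothesis.RiemannHypothesis.Theorems.PfPersistence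

end
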